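import Mathlib
import Summits.ValiantsHypothesis.ValiantsHypothesis.Theorems.NewtonUnitEquationsDissociatedUniformTotalsLaw
import Summits.ValiantsHypothesis.ValiantsHypothesis.Theorems.NewtonUnitEquationsDissociatedUniformTotalsLawUnion
import Summits.ValiantsHypothesis.ValiantsHypothesis.Theorems.NewtonUnitEquationsDissociatedUniformTotalsLawIntervalUnion
import Summits.ValiantsHypothesis.ValiantsHypothesis.Theorems.NewtonUnitEquationsDissociatedUniformTotalsLawIntervalUnionLogRuns
import Summits.ValiantsHypothesis.ValiantsHypothesis.Theorems.NewtonUnitEquationsDissociatedUniformTotalsLawUnionCosets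
import Summits.ValiantsHypothesis.ValiantsHypothesis.Theorems.NewtonUnitEquationsDissociatedUniformTotalsLawIntervalUnionLinear
import HarnessLib

/-!
# Crux `NewtonUnitEquations.DissociatedUniform` (stmt-ValiantsHypothesis-5905), `n = 3` totals law of model (Q**):
# unions of `r` cyclic windows, third curves with `r` runs, automorphic images — the interval stratum, LOG-FREE, arbitrary pairs

Corollaries of `…TotalsLawIntervalUnionLinear.unionVert_cycInterval_le` (`#vert conv U_s([t,t+m)) ≤ 24q` for ALL `a b : ℤ/q → ℝ²`),
the log-free versions of `…TotalsLawIntervalUnionLogRuns`: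
* `unionVert_intervals_le` — a position set that is a union of `r` cyclic windows (any lengths) has `#vert conv U_s(Z) ≤ r·24q` for
  every class, `unionTotal ≤ r·24q²` (`unionTotal_intervals_le`);
* `unionVert_addEquiv_cycInterval_le` — the same for automorphic images of windows (unit-step arithmetic progressions);
* `classVert_le_of_run_levels_linear` / `totalVert_le_of_run_levels_linear` — if the third curve `c` takes `≤ k` values and every level
  set is a union of `≤ r` cyclic windows, then `V_s ≤ k·r·24q` POINTWISE and `T(a,b,c) ≤ k·r·24q²`, for an ARBITRARY pair `a, b`.
Honest label: `UnionTotalsLaw C` (arbitrary position sets) and `TotalsLawThree C` remain OPEN and are asserted nowhere; nothing here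
bears on VP ≠ VNP. [folklore]
-/

set_option linter.dupNamespace false -- `ValiantsHypothesis.ValiantsHypothesis` (summit = problem) in every name

open Finset
open scoped Pointwise

namespace Summit.ValiantsHypothesis.ValiantsHypothesis.Theorems.NewtonUnitEquationsDissociatedUniform

namespace TotalsLaw

section Cyclic
variable {q : ℕ} [NeZero q]

/-! ### Unions of `r` windows, third curves with few runs, automorphic images — log-free -/

/-- **Unions of `r` cyclic windows:** `#vert conv U_s(⋃_{i∈R} [t_i, t_i+m_i)) ≤ |R|·24q` for all `a, b`, every class. -/
theorem unionVert_intervals_le {ι : Type*} (a b : ZMod q → (Fin 2 → ℝ)) (R : Finset ι) (t m : ι → ℕ) (s : ZMod q) :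
    unionVert a b (⋃ i ∈ R, (cycInterval q (t i) (m i) : Set (ZMod q))) s ≤ R.card * (24 * q) := by
  calc _ ≤ ∑ i ∈ R, unionVert a b (cycInterval q (t i) (m i) : Set (ZMod q)) s := unionVert_biUnion_le a b R _ s
    _ ≤ ∑ _i ∈ R, 24 * q := Finset.sum_le_sum fun i _ => unionVert_cycInterval_le a b (t i) (m i) s
    _ = R.card * (24 * q) := by rw [Finset.sum_const, smul_eq_mul]

/-- … and in total over the classes: `≤ |R|·24q²`. -/
theorem unionTotal_intervals_le {ι : Type*} (a b : ZMod q → (Fin 2 → ℝ)) (R : Finset ι) (t m : ι → ℕ) :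
    unionTotal a b (⋃ i ∈ R, (cycInterval q (t i) (m i) : Set (ZMod q))) ≤ R.card * (24 * q ^ 2) := by
  unfold unionTotal
  calc _ ≤ ∑ _s : ZMod q, R.card * (24 * q) := Finset.sum_le_sum fun s _ => unionVert_intervals_le a b R t m s
    _ = R.card * (24 * q ^ 2) := by rw [Finset.sum_const, Finset.card_univ, ZMod.card, smul_eq_mul]; ring

/-- **The `n = 3` law, POINTWISE, log-free, for a third curve with few runs and an ARBITRARY pair:** if `c` takes `≤ k` values and
every level set of `c` is a union of `≤ r` cyclic windows, then `V_s ≤ k·r·24q` for every class `s`. -/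
theorem classVert_le_of_run_levels_linear (a b c : ZMod q → (Fin 2 → ℝ)) [DecidableEq (Fin 2 → ℝ)] {k r : ℕ}
    (hk : (Finset.univ.image c).card ≤ k)
    (hc : ∀ v, ∃ R : Finset (ℕ × ℕ), R.card ≤ r ∧ c ⁻¹' {v} = ⋃ p ∈ R, (cycInterval q p.1 p.2 : Set (ZMod q)))
    (s : ZMod q) : classVert a b c s ≤ k * (r * (24 * q)) := by
  calc classVert a b c s ≤ ∑ v ∈ Finset.univ.image c, unionVert a b (c ⁻¹' {v}) s :=
        classVert_le_sum_unionVert a b c s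
    _ ≤ ∑ _v ∈ Finset.univ.image c, r * (24 * q) :=
        Finset.sum_le_sum fun v _ => by
          obtain ⟨R, hR, h⟩ := hc v
          rw [h]
          exact (unionVert_intervals_le a b R (fun p => p.1) (fun p => p.2) s).trans (Nat.mul_le_mul_right _ hR)
    _ ≤ k * (r * (24 * q)) := by
        rw [Finset.sum_const, smul_eq_mul]
        exact Nat.mul_le_mul_right _ hk

/-- **… and in TOTAL:** `T(a,b,c) ≤ k·r·24q²` for `a, b` arbitrary and `c` with `≤ k` values whose level sets are unions of `≤ r`
cyclic windows. -/
theorem totalVert_le_of_run_levels_linear (a b c : ZMod q → (Fin 2 → ℝ)) [DecidableEq (Fin 2 → ℝ)] {k r : ℕ}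
    (hk : (Finset.univ.image c).card ≤ k)
    (hc : ∀ v, ∃ R : Finset (ℕ × ℕ), R.card ≤ r ∧ c ⁻¹' {v} = ⋃ p ∈ R, (cycInterval q p.1 p.2 : Set (ZMod q))) :
    totalVert a b c ≤ k * (r * (24 * q ^ 2)) := by
  unfold totalVert
  calc ∑ s, classVert a b c s ≤ ∑ _s : ZMod q, k * (r * (24 * q)) :=
        Finset.sum_le_sum fun s _ => classVert_le_of_run_levels_linear a b c hk hc s
    _ = k * (r * (24 * q ^ 2)) := by rw [Finset.sum_const, Finset.card_univ, ZMod.card, smul_eq_mul]; ring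

/-- **Automorphic images of windows** (e.g. arithmetic progressions with a unit difference): `#vert conv U_s(φ[t,t+m)) ≤ 24q` for
every additive automorphism `φ` of `ℤ/q`, via the relabelling symmetry `…UnionCosets.unionVert_comp_addEquiv`. -/
theorem unionVert_addEquiv_cycInterval_le (a b : ZMod q → (Fin 2 → ℝ)) (φ : ZMod q ≃+ ZMod q) (t m : ℕ) (s : ZMod q) :
    unionVert a b (φ '' (cycInterval q t m : Set (ZMod q))) s ≤ 24 * q := by
  have h := unionVert_comp_addEquiv a b φ (cycInterval q t m : Set (ZMod q)) (φ.symm s)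
  rw [φ.apply_symm_apply] at h
  rw [← h]
  exact unionVert_cycInterval_le _ _ t m _

end Cyclic

end TotalsLaw

end Summit.ValiantsHypothesis.ValiantsHypothesis.Theorems.NewtonUnitEquationsDissociatedUniform
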